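/-
Origin: expansion seat `prover-pub-hodgecm-mc-sinst-1-g4-0`, handover #1216 2026-08-20T08:22Z md5 2b0be041a877 (190 l., 10 decls) NEW additive leaf after installed #1215 + RUN-45 #CA35 (← #CA34 ← #CA33 ← #CA32); (C-LINE1) R1′ S side: §1 SROGTC hΔ₁ hΔ₂ hΔ₃ := SROGT @hGR @(χVR @hGR @hGR₀ @hGR₁) @(νR @hGR₁) @(hνR @hGR₁) @(hνcR @hGR₁) @hGR₀..₃ @μ hΔ₁ hΔ₂ hΔ₃ (pin inputs hGR×5, μ, hΔ₁₂₃ ONLY — no χV, no ν hν hνc), SROGTC_eq_SROGT (rfl), hT_ROGTC/hLF_ROGTC (row 13 hypothesis-free), SROGTC_eq_archSideOfT (under GOG the pin = archSideOfT … (EtaChi.η χVR χWR) … (νR V c) … (hG_GOG V c hc) (ART …)), SROGTC_P_ω; §2 hdef_one_ROGTC/hdef_zero_ROGTC (= #CA33 hdef_*_R1) and hχ_one_ROGTC/hχ_zero_ROGTC (= #CA34 hχ_*_R1) at χV := χVR, χW := χWR, ν := νR, h₁W := hG_GOG, hpos := hpos_GOG, hemb := hc.1, hnV/hn₁ := #CA35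 hasArchType_χVR/ν₁R_of_GOG; install AFTER #CA35; drop with #CA32–#CA35; NAME LIST: HodgeCM.Model.SInstance.SROGTC_eq_SROGT · HodgeCM.Model.SInstance.hT_ROGTC · HodgeCM.Model.SInstance.hLF_ROGTC · HodgeCM.Model.SInstance.SROGTC_eq_archSideOfT · HodgeCM.Model.SInstance.SROGTC_P_ω · HodgeCM.Model.SInstance.hdef_one_ROGTC · HodgeCM.Model.SInstance.hdef_zero_ROGTC · HodgeCM.Model.SInstance.hχ_one_ROGTC · HodgeCM.Model.SInstance.hχ_zero_ROGTC ·  (`HOME/mc/pub-hodgecm-mc-sinst-1-g4/stage/HodgeCM/Model/ThetaAdelicSideR1.lean`, md5 2b0be041a877, 190 lines);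
landed by the gen-17 packager (p-g17) in gate run 45 as `HodgeCM/Model/ThetaAdelicSideR1.lean` (verbatim).
-/
/-
Origin: speedrun cell pub-hodgecm, MODEL-CONSTRUCTION sub-cell, lineage mc-sinst-1 (S-instance constructor, BINDER-OWNERS row 5 `S` + row 13 `hT`; (C-LINE1) R1′),
seat prover-pub-hodgecm-mc-sinst-1-g4-0 (gen 4), 2026-08-20.  Target in PKG: `HodgeCM/Model/ThetaAdelicSideR1.lean`
(NEW additive leaf; RUN 45 material; imports RUN-44 #1215 `Model/ThetaAdelicSideGuardedT` (sinst-1) + RUN-45 #CA35 `Model/ArchKTypeOfLineR1Family` (carch-1;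
chain #CA32 → #CA33 → #CA34 → #CA35); rowdep #CA35 ≺ this; nothing depends on this leaf).
KERNEL only: 0 records / `def … : Prop` / cites, 0 proof holes; intended closure {propext, Classical.choice, Quot.sound}.
-/
import Summits.HodgeConjecture.HodgeCM.Model.ThetaAdelicSideGuardedT_2
import Summits.HodgeConjecture.HodgeCM.Model.ArchKTypeOfLineR1Family

/-!
# (C-LINE1) R1′, S SIDE: the row-5 pin with `χV` AND the twist `ν` CONSTRUCTED — `SInstance.SROGTC` — and row 12's four PROVE inputs AT that pin

Model1's R1′ (STATUS l.12721) and carch-1-g4's (C-Λ) § 5 (#CA33 `ArchKTypeOfLineTables`, #CA34 `ArchKTypeOfLineSection`, #CA35 `ArchKTypeOfLineR1Family`):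
at #1215's ν-carrying OG pin `SInstance.SROGT` (inputs `hGR χV ν hν hνc hGR₀..₃ μ hΔ₁ hΔ₂ hΔ₃`) this leaf PLUGS IN carch-1's constructed families

  `χV := SInstance.χVR @hGR @hGR₀ @hGR₁` (`= EtaChi.χOfType nVRF`),  `ν := SInstance.νR @hGR₁` (`= νOf ν₁R`, `ν₁R = EtaChi.χOfType n₁RF`),
  `hν := SInstance.hνR @hGR₁`,  `hνc := SInstance.hνcR @hGR₁`

(`EtaChi.χOfType n V c = unitaryLineCharOfType (n V c)`: unitary-1's term chosen once from the tree existence theorem `exists_unitaryLineChar_hasArchType`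
[WeilBNT1967 Ch. VII §3 as reproduced in `Vendored/…/UnitaryLineCharacters`]; `νOf ν₁ V c = (x ↦ ν₁ (det x))`, `det = cmAdelicDet` [Mok2014 §1 p. 5 as reproduced in
`Vendored/…/UnitaryDualPairThetaKernelCMTwistDet`]), giving

* §1 **`SInstance.SROGTC @hGR @hGR₀ @hGR₁ @hGR₂ @hGR₃ @μ hΔ₁ hΔ₂ hΔ₃ : ∀ V c, ThetaAdelicSide V c`** — THE CONSTRUCTED ROW-5 PIN: inputs = the five
  [GR91 3.1.1] splitting families, E's `μ` table (row 6) and the three guarded (J-μ) identities ONLY (no character family, no twist family);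
  `SROGTC_eq_SROGT` (rfl), rows `hLF` / 13 hypothesis-free (`hLF_ROGTC`, `hT_ROGTC`), and `SROGTC_eq_archSideOfT`: under `GOG V c` the pin IS period-1's
  twisted term `archSideOfT … (EtaChi.η χVR χWR V c) … (νR V c) … (hG_GOG V c hc) (ART …)` — so the cross-checked row-12 producer socket
  `archKTypeOfSideG … (archSideOfT …) … (archSideOfT_eq_archSideOfChar …)` (period-1 l.12822) applies verbatim;
* §2 **ROW 12's FOUR PROVE INPUTS AT THIS PIN ARE THEOREMS**: `hdef_zero_ROGTC` / `hdef_one_ROGTC` (= #CA33 `hdef_zero_R1` / `hdef_one_R1`: the `hdef`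
  hypotheses of #CA27 `harch_zero/one_of_defTypeG`, (c5)₀/(c5)₁) and `hχ_zero_ROGTC` / `hχ_one_ROGTC` (= #CA34 `hχ_zero_R1` / `hχ_one_R1`: the `hχ₀`/`hχ₁`
  inputs of #CA25 `archKTypeOfSideG`, (χ)₀/(χ)₁), each STATED at the pin's own `η := EtaChi.η χVR χWR V c`, `ν := νR V c`, `h₁W := hG_GOG V c hc`,
  `hpos₀/hpos₁ := (hpos_GOG V c hc).1/.2.1`, with the `HasArchType` hypotheses DISCHARGED by #CA35 `hasArchType_χVR_of_GOG` / `hasArchType_ν₁R_of_GOG`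
  and `hemb := hc.1`.
Pin-level E consequence (glue-1's R1-pin child, its count l.≈12913: 22 → 17 groups): `S := SInstance.SROGTC @hGR @hGR₀ @hGR₁ @hGR₂ @hGR₃ @μ hΔ₁ hΔ₂ hΔ₃`,
`hT := SInstance.hT_ROGTC (same)`; E's data group `χV` ↦ the term `SInstance.χVR @hGR @hGR₀ @hGR₁` everywhere (W pin, rows 18/19); `harch₀ hχ₀ harch₁ hχ₁`
↦ `harch_zero/one_of_defTypeG … (defExponentZero/One_spec …) (hdef_zero/one_ROGTC …)` and `hχ_zero/one_ROGTC …`.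
Nothing here is a claim of PerL/QW8; nothing is cited as a fact.
-/

set_option autoImplicit false

noncomputable section

open scoped Matrix Classical
open Literature.NumberTheory.Automorphic Literature.NumberTheory.Weil1964
open Literature.NumberTheory.GelbartRogawski1991.UnitaryDualPair
open HodgeCM.Adelic HodgeCM.PerL34
open Literature.Geometry.ComplexHyperbolic.BallModel (U21 x₀ stabilizerEquivK21)
open Literature.NumberTheory.Automorphic.U21 (matA sclD)

namespace HodgeCM.Model.SInstance

open HodgeCM.Model.ArchSideTerm

variable
  (hGR : ∀ {L : CMField} {ι₁ : L →+* ℂ} (V : HermSpace3 L ι₁) (c : SeesawCtx L),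
    (cmSplittingDatum (L : Type) finProdFinEquiv (frameD V) (frameD_real V) (frameD_ne V) (dW c.D) (dW_real c.D)
      (dW_ne c.D)).CompatibleSplitting)
  (hGR₀ : ∀ {L : CMField} {ι₁ : L →+* ℂ} (V : HermSpace3 L ι₁) (c : SeesawCtx L),
    (cmSplittingDatum (L : Type) (e₁) (frameD V) (frameD_real V) (frameD_ne V) (lineVec (L : Type) (dW c.D 0))
      (fun _ => dW_real c.D 0) (fun _ => dW_ne c.D 0)).CompatibleSplitting)
  (hGR₁ : ∀ {L : CMField} {ι₁ : L →+* ℂ} (V : HermSpace3 L ι₁) (c : SeesawCtx L),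
    (cmSplittingDatum (L : Type) (e₁) (frameD V) (frameD_real V) (frameD_ne V) (lineVec (L : Type) (dW c.D 1))
      (fun _ => dW_real c.D 1) (fun _ => dW_ne c.D 1)).CompatibleSplitting)
  (hGR₂ : ∀ {L : CMField} {ι₁ : L →+* ℂ} (V : HermSpace3 L ι₁) (c : SeesawCtx L),
    (cmSplittingDatum (L : Type) (e₁) (frameD V) (frameD_real V) (frameD_ne V) (lineVec (L : Type) (dW' c.D 0))
      (fun _ => dW'_real c.D 0) (fun _ => dW'_ne c.D 0)).CompatibleSplitting)
  (hGR₃ : ∀ {L : CMField} {ι₁ : L →+* ℂ} (V : HermSpace3 L ι₁) (c : SeesawCtx L),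
    (cmSplittingDatum (L : Type) (e₁) (frameD V) (frameD_real V) (frameD_ne V) (lineVec (L : Type) (dW' c.D 1))
      (fun _ => dW'_real c.D 1) (fun _ => dW'_ne c.D 1)).CompatibleSplitting)
  (μ : ∀ {L : CMField}, SeesawCtx L → Fin 4 → NumberField.InfinitePlace (L : Type) → ℤ)

/-! ## § 1 the constructed row-5 pin `SROGTC` -/

/-- **THE CONSTRUCTED ROW-5 PIN AT THE OG GUARD** (`orientBitι`): #1215's `SROGT` at `χV := χVR`, `ν := νR`, `hν := hνR`, `hνc := hνcR` (carch-1 #CA35) —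
pin inputs hGR×5, `μ` and the three guarded (J-μ) identities ONLY. -/
abbrev SROGTC
    (hΔ₁ : ∀ {L : CMField} {ι₁ : L →+* ℂ} (V : HermSpace3 L ι₁) (c : SeesawCtx L), ∀ hc : GOG V c,
      slotTypeVec V c (hGR V c) (hGR₀ V c) (hGR₁ V c) (hGR₂ V c) (hGR₃ V c) (hG_GOG V c hc) 1 -
        slotTypeVec V c (hGR V c) (hGR₀ V c) (hGR₁ V c) (hGR₂ V c) (hGR₃ V c) (hG_GOG V c hc) 0 = μ c 1 - μ c 0)
    (hΔ₂ : ∀ {L : CMField} {ι₁ : L →+* ℂ} (V : HermSpace3 L ι₁) (c : SeesawCtx L), ∀ hc : GOG V c,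
      slotTypeVec V c (hGR V c) (hGR₀ V c) (hGR₁ V c) (hGR₂ V c) (hGR₃ V c) (hG_GOG V c hc) 2 -
        slotTypeVec V c (hGR V c) (hGR₀ V c) (hGR₁ V c) (hGR₂ V c) (hGR₃ V c) (hG_GOG V c hc) 0 = μ c 2 - μ c 0)
    (hΔ₃ : ∀ {L : CMField} {ι₁ : L →+* ℂ} (V : HermSpace3 L ι₁) (c : SeesawCtx L), ∀ hc : GOG V c,
      slotTypeVec V c (hGR V c) (hGR₀ V c) (hGR₁ V c) (hGR₂ V c) (hGR₃ V c) (hG_GOG V c hc) 3 -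
        slotTypeVec V c (hGR V c) (hGR₀ V c) (hGR₁ V c) (hGR₂ V c) (hGR₃ V c) (hG_GOG V c hc) 0 = μ c 3 - μ c 0) :
    ∀ {L : CMField} {ι₁ : L →+* ℂ} (V : HermSpace3 L ι₁) (c : SeesawCtx L), ThetaAdelicSide V c :=
  SROGT @hGR @(@χVR @hGR @hGR₀ @hGR₁) @(@νR @hGR₁) @(@hνR @hGR₁) @(@hνcR @hGR₁) @hGR₀ @hGR₁ @hGR₂ @hGR₃ @μ hΔ₁ hΔ₂ hΔ₃

/-- `SROGTC` is #1215's `SROGT` at carch-1's constructed families (definitional). -/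
theorem SROGTC_eq_SROGT (hΔ₁ hΔ₂ hΔ₃) {L : CMField} {ι₁ : L →+* ℂ} (V : HermSpace3 L ι₁) (c : SeesawCtx L) :
    SROGTC @hGR @hGR₀ @hGR₁ @hGR₂ @hGR₃ @μ hΔ₁ hΔ₂ hΔ₃ V c =
      SROGT @hGR @(@χVR @hGR @hGR₀ @hGR₁) @(@νR @hGR₁) @(@hνR @hGR₁) @(@hνcR @hGR₁) @hGR₀ @hGR₁ @hGR₂ @hGR₃ @μ hΔ₁ hΔ₂ hΔ₃ V c :=
  rfl

/-- **row 13 `hT` at the constructed pin, hypothesis-free.** -/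
theorem hT_ROGTC (hΔ₁ hΔ₂ hΔ₃) : ∀ {L : CMField} {ι₁ : L →+* ℂ} (V : HermSpace3 L ι₁) (c : SeesawCtx L) (k : Fin 4) (N : ℕ),
    ((SROGTC @hGR @hGR₀ @hGR₁ @hGR₂ @hGR₃ @μ hΔ₁ hΔ₂ hΔ₃ V c).P k).IsThetaArchContinuous N :=
  hT_ROGT _ _ _ _ _ _ _ _ _ _ hΔ₁ hΔ₂ hΔ₃

/-- `hLF` at the constructed pin, hypothesis-free. -/
theorem hLF_ROGTC (hΔ₁ hΔ₂ hΔ₃) : ∀ {L : CMField} {ι₁ : L →+* ℂ} (V : HermSpace3 L ι₁) (c : SeesawCtx L) (k : Fin 4),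
    ((SROGTC @hGR @hGR₀ @hGR₁ @hGR₂ @hGR₃ @μ hΔ₁ hΔ₂ hΔ₃ V c).P k).IsLFAction :=
  hLF_ROGT _ _ _ _ _ _ _ _ _ _ hΔ₁ hΔ₂ hΔ₃

/-- **under the OG guard the constructed pin IS period-1's twisted term** at `η := EtaChi.η χVR χWR`, `ν := νR V c`, `h₁W := hG_GOG V c hc` and the
transported read-off inputs `ART` — so the cross-checked row-12 producer socket `archKTypeOfSideG … (archSideOfT …) … (archSideOfT_eq_archSideOfChar …)` applies. -/
theorem SROGTC_eq_archSideOfT (hΔ₁ hΔ₂ hΔ₃) {L : CMField} {ι₁ : L →+* ℂ} (V : HermSpace3 L ι₁) (c : SeesawCtx L) (hc : GOG V c) :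
    SROGTC @hGR @hGR₀ @hGR₁ @hGR₂ @hGR₃ @μ hΔ₁ hΔ₂ hΔ₃ V c =
      archSideOfT V c (hGR V c) (hGR₀ V c) (hGR₁ V c) (hGR₂ V c) (hGR₃ V c)
        (EtaChi.η (@χVR @hGR @hGR₀ @hGR₁) (@χWR @hGR @hGR₀ @hGR₁ @μ) V c)
        (EtaChi.hη (@χVR @hGR @hGR₀ @hGR₁) (@χWR @hGR @hGR₀ @hGR₁ @μ) V c)
        (EtaChi.hηc (@χVR @hGR @hGR₀ @hGR₁) (@χWR @hGR @hGR₀ @hGR₁ @μ) V c)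
        (νR @hGR₁ V c) (hνR @hGR₁ V c) (hνcR @hGR₁ V c) (hG_GOG V c hc)
        (ART @GOG @hG_GOG @hGR @(@χVR @hGR @hGR₀ @hGR₁) @(@νR @hGR₁) @hGR₀ @hGR₁ @hGR₂ @hGR₃ @μ @hpos_GOG @hΔ₁ @hΔ₂ @hΔ₃ V c hc) :=
  thetaAdelicSideOfPT_eq_archSideOfT V c (GOG V c) _ _ _ _ _ _ _ _ _ _ _ _ _ hc

/-- read-back of a line kernel of the constructed pin under the guard: `(P k).ω = lineRepT … (EtaChi.η χVR χWR V c) (νR V c) k`. -/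
theorem SROGTC_P_ω (hΔ₁ hΔ₂ hΔ₃) {L : CMField} {ι₁ : L →+* ℂ} (V : HermSpace3 L ι₁) (c : SeesawCtx L) (hc : GOG V c) (k : Fin 4) :
    ((SROGTC @hGR @hGR₀ @hGR₁ @hGR₂ @hGR₃ @μ hΔ₁ hΔ₂ hΔ₃ V c).P k).ω =
      lineRepT V c.D (hGR V c) (hGR₀ V c) (hGR₁ V c) (hGR₂ V c) (hGR₃ V c)
        (EtaChi.η (@χVR @hGR @hGR₀ @hGR₁) (@χWR @hGR @hGR₀ @hGR₁ @μ) V c) (νR @hGR₁ V c) k := by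
  rw [SROGTC_eq_archSideOfT @hGR @hGR₀ @hGR₁ @hGR₂ @hGR₃ @μ hΔ₁ hΔ₂ hΔ₃ V c hc]
  rfl

/-! ## § 2 row 12's four PROVE inputs at the constructed pin -/

/-- **(c5)₁ AT THE CONSTRUCTED PIN**: the `hdef` hypothesis of #CA27 `harch_one_of_defTypeG` HOLDS for the pin's line-1 split
`η₁ := etaT₁ … (EtaChi.η χVR χWR V c) (νR V c)` and `a := defExponentOne …` (#CA33 `hdef_one_R1`, `hn₁ := hasArchType_ν₁R_of_GOG`). -/
theorem hdef_one_ROGTC {L : CMField} {ι₁ : L →+* ℂ} (V : HermSpace3 L ι₁) (c : SeesawCtx L) (hc : GOG V c) :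
    ∀ b : {v : NumberField.InfinitePlace ↥(NumberField.maximalRealSubfield L) // v.IsReal}, b ≠ HypCensus.cmPlace (L : Type) ι₁ →
      ∀ u : ↥(UnitaryGroup.archLocal (L : Type) 3 (Matrix.diagonal (frameD V)) (cmPlaceOver (L : Type) b)),
        ((archScalar_oneG V c.D (hGR V c) (hGR₀ V c) (hGR₁ V c)
            (etaT₁ V c.D (EtaChi.η (@χVR @hGR @hGR₀ @hGR₁) (@χWR @hGR @hGR₀ @hGR₁ @μ) V c) (νR @hGR₁ V c))
            (UnitaryGroup.archSingle (↥(NumberField.maximalRealSubfield L)) L (NumberField.IsCMField.complexConj L) 3 (Matrix.diagonal (frameD V))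
              (NumberField.IsCMField.complexConj_ne_one L) (UnitaryGroup.complexConj_smul_infinitePlace (L : Type)) (cmPlaceOver (L : Type) b) u) :
            ℂˣ) : ℂ) *
          (((u : ↥(UnitaryGroup.archLocal (L : Type) 3 (Matrix.diagonal (frameD V)) (cmPlaceOver (L : Type) b))) : GL (Fin 3) ℂ) :
              Matrix (Fin 3) (Fin 3) ℂ).det ^ defExponentOne V c (hGR₁ V c) (hpos_GOG V c hc).2.1 b = 1 :=
  hdef_one_R1 (χV := @χVR @hGR @hGR₀ @hGR₁) (χW := @χWR @hGR @hGR₀ @hGR₁ @μ) (ν₁ := @ν₁R @hGR₁) V c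
    (hGR := hGR V c) (hGR₀ := hGR₀ V c) (hGR₁ := hGR₁ V c) (h₁W := hG_GOG V c hc) (hpos₁ := (hpos_GOG V c hc).2.1)
    (hn₁ := hasArchType_ν₁R_of_GOG @hGR₁ V c hc)

/-- **(c5)₀ AT THE CONSTRUCTED PIN**: the `hdef` hypothesis of #CA27 `harch_zero_of_defTypeG` HOLDS for the pin's line-0 split
`η₀ := etaT₀ … (EtaChi.η χVR χWR V c) (νR V c)` and `a := defExponentZero …` (#CA33 `hdef_zero_R1`, `hnV := hasArchType_χVR_of_GOG`, `hn₁ := hasArchType_ν₁R_of_GOG`). -/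
theorem hdef_zero_ROGTC {L : CMField} {ι₁ : L →+* ℂ} (V : HermSpace3 L ι₁) (c : SeesawCtx L) (hc : GOG V c) :
    ∀ b : {v : NumberField.InfinitePlace ↥(NumberField.maximalRealSubfield L) // v.IsReal}, b ≠ HypCensus.cmPlace (L : Type) ι₁ →
      ∀ u : ↥(UnitaryGroup.archLocal (L : Type) 3 (Matrix.diagonal (frameD V)) (cmPlaceOver (L : Type) b)),
        ((archScalar_zeroG V c.D (hGR V c) (hGR₀ V c) (hGR₁ V c)
            (etaT₀ V c.D (EtaChi.η (@χVR @hGR @hGR₀ @hGR₁) (@χWR @hGR @hGR₀ @hGR₁ @μ) V c) (νR @hGR₁ V c))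
            (UnitaryGroup.archSingle (↥(NumberField.maximalRealSubfield L)) L (NumberField.IsCMField.complexConj L) 3 (Matrix.diagonal (frameD V))
              (NumberField.IsCMField.complexConj_ne_one L) (UnitaryGroup.complexConj_smul_infinitePlace (L : Type)) (cmPlaceOver (L : Type) b) u) :
            ℂˣ) : ℂ) *
          (((u : ↥(UnitaryGroup.archLocal (L : Type) 3 (Matrix.diagonal (frameD V)) (cmPlaceOver (L : Type) b))) : GL (Fin 3) ℂ) :
              Matrix (Fin 3) (Fin 3) ℂ).det ^ defExponentZero V c (hGR₀ V c) (hpos_GOG V c hc).1 b = 1 :=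
  hdef_zero_R1 (χV := @χVR @hGR @hGR₀ @hGR₁) (χW := @χWR @hGR @hGR₀ @hGR₁ @μ) (ν₁ := @ν₁R @hGR₁) V c
    (hGR := hGR V c) (hGR₀ := hGR₀ V c) (hGR₁ := hGR₁ V c) (h₁W := hG_GOG V c hc) (hpos₀ := (hpos_GOG V c hc).1) (hpos₁ := (hpos_GOG V c hc).2.1)
    (hnV := hasArchType_χVR_of_GOG @hGR @hGR₀ @hGR₁ V c hc) (hn₁ := hasArchType_ν₁R_of_GOG @hGR₁ V c hc)

/-- **(χ)₁ AT THE CONSTRUCTED PIN**: the `hχ₁` input of #CA25 `archKTypeOfSideG` HOLDS for `η₁ := etaT₁ … (EtaChi.η χVR χWR V c) (νR V c)`,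
`ev := lineVacExponentsOne … (hG_GOG V c hc) …` (#CA34 `hχ_one_R1`, `hemb := hc.1`, `hn₁ := hasArchType_ν₁R_of_GOG`). -/
theorem hχ_one_ROGTC {L : CMField} {ι₁ : L →+* ℂ} (V : HermSpace3 L ι₁) (c : SeesawCtx L) (hc : GOG V c) (u : MulAction.stabilizer U21 x₀) :
    ((lineScalar_one V c.D (hGR V c) (hGR₀ V c) (hGR₁ V c)
        (etaT₁ V c.D (EtaChi.η (@χVR @hGR @hGR₀ @hGR₁) (@χWR @hGR @hGR₀ @hGR₁ @μ) V c) (νR @hGR₁ V c)) (u : U21) : ℂˣ) : ℂ) *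
        ((matA (stabilizerEquivK21.symm u)).det ^
            (lineVacExponentsOne V c (hGR₁ V c) (hG_GOG V c hc) (posIdxEquivUnit (hpos_GOG V c hc).2.1) (negIdxEquivEmpty (hpos_GOG V c hc).2.1)).eP *
          sclD (stabilizerEquivK21.symm u) ^
            (lineVacExponentsOne V c (hGR₁ V c) (hG_GOG V c hc) (posIdxEquivUnit (hpos_GOG V c hc).2.1) (negIdxEquivEmpty (hpos_GOG V c hc).2.1)).eQ) =
      star (sclD (stabilizerEquivK21.symm u)) :=
  hχ_one_R1 (χV := @χVR @hGR @hGR₀ @hGR₁) (χW := @χWR @hGR @hGR₀ @hGR₁ @μ) (ν₁ := @ν₁R @hGR₁) V c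
    (hGR := hGR V c) (hGR₀ := hGR₀ V c) (hGR₁ := hGR₁ V c) (h₁W := hG_GOG V c hc) (hpos₁ := (hpos_GOG V c hc).2.1) (hemb := hc.1)
    (hn₁ := hasArchType_ν₁R_of_GOG @hGR₁ V c hc) u

/-- **(χ)₀ AT THE CONSTRUCTED PIN**: the `hχ₀` input of #CA25 `archKTypeOfSideG` HOLDS for `η₀ := etaT₀ … (EtaChi.η χVR χWR V c) (νR V c)`,
`ev := lineVacExponentsZero … (hG_GOG V c hc) …` (#CA34 `hχ_zero_R1`, `hemb := hc.1`, `hnV := hasArchType_χVR_of_GOG`, `hn₁ := hasArchType_ν₁R_of_GOG`). -/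
theorem hχ_zero_ROGTC {L : CMField} {ι₁ : L →+* ℂ} (V : HermSpace3 L ι₁) (c : SeesawCtx L) (hc : GOG V c) (u : MulAction.stabilizer U21 x₀) :
    ((lineScalar_zero V c.D (hGR V c) (hGR₀ V c) (hGR₁ V c)
        (etaT₀ V c.D (EtaChi.η (@χVR @hGR @hGR₀ @hGR₁) (@χWR @hGR @hGR₀ @hGR₁ @μ) V c) (νR @hGR₁ V c)) (u : U21) : ℂˣ) : ℂ) *
        ((matA (stabilizerEquivK21.symm u)).det ^
            (lineVacExponentsZero V c (hGR₀ V c) (hG_GOG V c hc) (posIdxEquivUnit (hpos_GOG V c hc).1) (negIdxEquivEmpty (hpos_GOG V c hc).1)).eP *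
          sclD (stabilizerEquivK21.symm u) ^
            (lineVacExponentsZero V c (hGR₀ V c) (hG_GOG V c hc) (posIdxEquivUnit (hpos_GOG V c hc).1) (negIdxEquivEmpty (hpos_GOG V c hc).1)).eQ) =
      star (sclD (stabilizerEquivK21.symm u)) :=
  hχ_zero_R1 (χV := @χVR @hGR @hGR₀ @hGR₁) (χW := @χWR @hGR @hGR₀ @hGR₁ @μ) (ν₁ := @ν₁R @hGR₁) V c
    (hGR := hGR V c) (hGR₀ := hGR₀ V c) (hGR₁ := hGR₁ V c) (h₁W := hG_GOG V c hc) (hpos₀ := (hpos_GOG V c hc).1) (hpos₁ := (hpos_GOG V c hc).2.1)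
    (hemb := hc.1) (hnV := hasArchType_χVR_of_GOG @hGR @hGR₀ @hGR₁ V c hc) (hn₁ := hasArchType_ν₁R_of_GOG @hGR₁ V c hc) u

end HodgeCM.Model.SInstance

end
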